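import Summits.Ventures.Crystal3D.Theorems.StickyWulffConstantCoaxialWallLawPayerTrans
import Summits.Ventures.Crystal3D.Theorems.StickyWulffConstantCoaxialWallLawPayerTwin
import Summits.Ventures.Crystal3D.Theorems.StickyWulffConstantCoaxialWallLawExactUnion
import Summits.Ventures.Crystal3D.Theorems.StickyWulffConstantGenericWallFloorAffineSampleDeficit
import Summits.Ventures.Crystal3D.Theorems.StickyWulffConstantCoaxialWallLawWallLedgerFDefs
import Summits.Ventures.Crystal3D.StickySpheres.FinsetBridge
import HarnessLib

/-!
# Branch F census-free IX: the UNION — `stub_coaxialTwoSlabAdhesion`'s inequality and the crux `CoaxialWallLaw`'s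
# statement at the uniform charge `1/156` in place of `½`, for EVERY co-axial pair, modulo `KissingGap δ`,
# `KissingClassification δ` ONLY

HONEST FRAMING. Venture `Summits/Ventures/Crystal3D` (cell `crystal3d-full`), helper `--supports` the crux
`CoaxialWallLaw` (stmt-Ventures-19481) of `route-Ventures-StickyWulffConstant`, REGISTERED line `WallLedgerF`
(planner cf-p1; stubs `stub_affineSampleDeficit`, `stub_coaxialTwoSlabAdhesion` of `…WallLedgerFDefs`).
RUNG CREDIT ONLY; F-C1 not moved; the crux (charge `½·sin θ`) is NOT closed here.

WHY THIS FILE.  `coaxialTwoSlabAdhesion_of_census` (`…HalfUnion`) / `coaxialWallLaw_of_census` (`…OfCensus`) carry the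
REFUTED inputs `hcertA` (A12-583 glide star) and `KFoldTopDeficit` (cf-p1 ROUTE §84 (xii): inadmissible).  F's STANDING law is
census-free: 19481-p2 g3's `coaxialWallLaw_smallCharge` (`√2/11440`), 19481-p1 g6's twin law `…PayerTwin` (`√6/312`), and
this seat's translation port `…PayerInstanceInv` → `…PayerTransCell*` → `…PayerTrans`.  This file is the union:

* `coaxialTwoSlabAdhesion_translate_censusFree` — translation pairs (`A₁·Λ₀ = A₂·Λ₀`, `Λ₁ ≠ Λ₂`): for SOME frame,
  charge `(1/156)·sin θ`: (A) 3-adically generic offset ⇒ `1/156` orientation-free; (B) doubly skew axis ⇒ the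
  defender RE-PICKS the axis `L'`, skew root of rise `≥ sin θ'/√2` (`exists_skewRoot_of_axis_sine`) ⇒ `(1/156)·sin θ'`
  EXACTLY; (C) skew `{111}` sign pattern ⇒ frame `L'` with every off-plane slot skew ⇒ `(√6/312)·sin θ' ≥ (1/156)·sin θ'`.
* **`coaxialTwoSlabAdhesion_censusFree`** — the text of `CoaxialTwoSlabAdhesion` (`…WallLedgerFDefs`) with
  `(1 / 2 : ℝ)` replaced by `(1 / 156 : ℝ)`: EVERY co-axial pair of distinct moved fcc lattices, arbitrary
  fillings, no residual, h-uniform; twins by `coaxialTwoSlabAdhesion_general_twin_censusFree` (`√6/312 ≥ 1/156`).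
* `coaxialWallLaw_at_of_adhesion_at` — the planner's skeleton composition `AffineSampleDeficit → (stub at charge c)
  → (crux at charge c)`, UNIFORM in the constant `c` (the text of `coaxialWallLaw_of_stubProps` of `…OfCensus` with
  `½ ↦ c`; turnkey for every future constant).
* **`coaxialWallLaw_censusFree`** — the crux's statement VERBATIM with `(1 / 2 : ℝ) ↦ (1 / 156 : ℝ)`, modulo
  `KissingGap δ`, `KissingClassification δ` ONLY (admissible list (xii) ✓): ×52 over `√2/11440`.  «Every wall
  between two distinct co-axial fcc grains costs at least `(1/156)·sin θ` per unit area beyond the two free surfaces,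
  for the defender's axis, uniformly in the thickness and the filling.»

WHAT THIS IS NOT: the stub or the crux (constant `½`); no census row, no `KFoldTopDeficit`; F-C1 not moved.
-/

noncomputable section

namespace Summit.Ventures.Crystal3D.Theorems

open Summit.Ventures.Crystal3D Finset Real NearIdentity
open Summit.Ventures.Crystal3D.Cruxes.CoaxialWallLaw.WallLedgerF (AffineSampleDeficit)
open Literature.MathematicalPhysics.StatisticalMechanics (fccStacking barlowStacking IsHaggSeq constHagg
  isHaggSeq_const contactDeficiency)
open scoped InnerProductSpace

section CensusFree

variable {δ : ℝ} (hg : KissingGap δ) (hc : KissingClassification δ)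
include hg hc

open scoped Classical in
/-- **Census-free TRANSLATION pairs** (`A₁·Λ₀ = A₂·Λ₀`, `Λ₁ ≠ Λ₂`): for SOME frame, charge `(1/156)·sin θ`, modulo
`KissingGap δ`, `KissingClassification δ` only.  See the module docstring. -/
theorem coaxialTwoSlabAdhesion_translate_censusFree
    (A₁ : EuclideanSpace ℝ (Fin 3) ≃ₗᵢ[ℝ] EuclideanSpace ℝ (Fin 3)) (t₁ : EuclideanSpace ℝ (Fin 3))
    (A₂ : EuclideanSpace ℝ (Fin 3) ≃ₗᵢ[ℝ] EuclideanSpace ℝ (Fin 3)) (t₂ : EuclideanSpace ℝ (Fin 3))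
    (L : EuclideanSpace ℝ (Fin 3) ≃ₗᵢ[ℝ] EuclideanSpace ℝ (Fin 3)) (s₁ s₂ : EuclideanSpace ℝ (Fin 3))
    (σ σ' : ℤ → ℤ) (hσ : IsHaggSeq σ) (hσ' : IsHaggSeq σ')
    (hsub₁ : (fun p => A₁ p + t₁) '' fccStacking 1 (Real.sqrt (2 / 3)) ⊆
      (fun p => L p + s₁) '' barlowStacking 1 (Real.sqrt (2 / 3)) σ)
    (hsub₂ : (fun p => A₂ p + t₂) '' fccStacking 1 (Real.sqrt (2 / 3)) ⊆
      (fun p => L p + s₂) '' barlowStacking 1 (Real.sqrt (2 / 3)) σ')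
    (htrans : A₁ '' fccStacking 1 (Real.sqrt (2 / 3)) = A₂ '' fccStacking 1 (Real.sqrt (2 / 3)))
    (hne : (fun p => A₁ p + t₁) '' fccStacking 1 (Real.sqrt (2 / 3)) ≠
      (fun p => A₂ p + t₂) '' fccStacking 1 (Real.sqrt (2 / 3))) :
    ∃ (L : EuclideanSpace ℝ (Fin 3) ≃ₗᵢ[ℝ] EuclideanSpace ℝ (Fin 3))
        (s₁ s₂ : EuclideanSpace ℝ (Fin 3)) (σ σ' : ℤ → ℤ), IsHaggSeq σ ∧ IsHaggSeq σ' ∧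
        (fun p => A₁ p + t₁) '' fccStacking 1 (Real.sqrt (2 / 3)) ⊆
          (fun p => L p + s₁) '' barlowStacking 1 (Real.sqrt (2 / 3)) σ ∧
        (fun p => A₂ p + t₂) '' fccStacking 1 (Real.sqrt (2 / 3)) ⊆
          (fun p => L p + s₂) '' barlowStacking 1 (Real.sqrt (2 / 3)) σ' ∧
    ∃ C R₀ : ℝ, 1 ≤ R₀ ∧ ∀ h : ℝ, 0 ≤ h → ∀ ρ : ℝ, R₀ ≤ ρ →
      ∀ X P₁ P₂ : Finset (EuclideanSpace ℝ (Fin 3)),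
      (∀ p ∈ X, ∀ q ∈ X, p ≠ q → 1 ≤ dist p q) → P₁ ⊆ X → P₂ ⊆ X \ P₁ →
      (∀ p ∈ X, -(2 * R₀) ≤ p 2 ∧ p 2 ≤ h + 2 * R₀ ∧ p 0 ^ 2 + p 1 ^ 2 ≤ ρ ^ 2) →
      (∀ p, p ∈ P₁ ↔ (p ∈ (fun q => A₁ q + t₁) '' fccStacking 1 (Real.sqrt (2 / 3)) ∧
        -(2 * R₀) ≤ p 2 ∧ p 2 ≤ -R₀ ∧ p 0 ^ 2 + p 1 ^ 2 ≤ ρ ^ 2)) →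
      (∀ p, p ∈ P₂ ↔ (p ∈ (fun q => A₂ q + t₂) '' fccStacking 1 (Real.sqrt (2 / 3)) ∧
        h + R₀ ≤ p 2 ∧ p 2 ≤ h + 2 * R₀ ∧ p 0 ^ 2 + p 1 ^ 2 ≤ ρ ^ 2)) →
      ((((P₁ ×ˢ (X \ P₁)).filter fun pq => dist pq.1 pq.2 = 1).card : ℕ) : ℝ) +
        ((((P₂ ×ˢ ((X \ P₁) \ P₂)).filter fun pq => dist pq.1 pq.2 = 1).card : ℕ) : ℝ) ≤
        contactDeficiency ((X \ P₁) \ P₂) +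
          (Real.sqrt 2 / 4 * ∑ᶠ w ∈ {w ∈ fccStacking 1 (Real.sqrt (2 / 3)) | ‖w‖ = 1},
              |⟪w, A₁.symm (EuclideanSpace.single (2 : Fin 3) (1 : ℝ))⟫_ℝ| +
            Real.sqrt 2 / 4 * ∑ᶠ w ∈ {w ∈ fccStacking 1 (Real.sqrt (2 / 3)) | ‖w‖ = 1},
              |⟪w, A₂.symm (EuclideanSpace.single (2 : Fin 3) (1 : ℝ))⟫_ℝ| -
            (1 / 156 : ℝ) * Real.sqrt (1 - ⟪L (EuclideanSpace.single (2 : Fin 3) (1 : ℝ)),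
              (EuclideanSpace.single (2 : Fin 3) (1 : ℝ))⟫_ℝ ^ 2)) * Real.pi * ρ ^ 2 +
          C * (1 + h) * ρ := by
  set e₃ : EuclideanSpace ℝ (Fin 3) := EuclideanSpace.single (2 : Fin 3) (1 : ℝ) with he₃
  set τ : EuclideanSpace ℝ (Fin 3) := A₁.symm (t₂ - t₁) with hτ
  have hτΛ : τ ∉ fccStacking 1 (Real.sqrt (2 / 3)) := offset_notMem_of_ne A₁ A₂ t₁ t₂ htrans hne
  have hsin : ∀ M : EuclideanSpace ℝ (Fin 3) ≃ₗᵢ[ℝ] EuclideanSpace ℝ (Fin 3),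
      0 ≤ Real.sqrt (1 - ⟪M e₃, e₃⟫_ℝ ^ 2) ∧ Real.sqrt (1 - ⟪M e₃, e₃⟫_ℝ ^ 2) ≤ 1 := by
    intro M
    refine ⟨Real.sqrt_nonneg _, ?_⟩
    rw [show (1 : ℝ) = Real.sqrt 1 from Real.sqrt_one.symm]
    exact Real.sqrt_le_sqrt (by rw [Real.sqrt_one]; nlinarith [sq_nonneg ⟪M e₃, e₃⟫_ℝ])
  have hπρ : ∀ ρ : ℝ, 0 ≤ Real.pi * ρ ^ 2 := fun ρ => by positivity
  have hΛ₂ : A₂ '' fccStacking 1 (Real.sqrt (2 / 3)) = A₁ '' fccStacking 1 (Real.sqrt (2 / 3)) := htrans.symm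
  rcases skew_trichotomy_fin τ with hall | ⟨k, hk⟩ | ⟨c, hcube⟩
  · -- (A) generic offset: orientation-free `1/156`, frame `L`
    obtain ⟨C, R₀, hR₀, hmain⟩ := translate_twoSlabAdhesion_generic_censusFree hg hc A₁ t₁ A₂ t₂ htrans
      (fun k => generic_of_allInt τ hall hτΛ k)
    refine ⟨L, s₁, s₂, σ, σ', hσ, hσ', hsub₁, hsub₂, C, R₀, hR₀, ?_⟩
    intro h hh ρ hρ X P₁ P₂ hX hP₁X hP₂X₁ hcyl hP₁ hP₂
    have key := hmain h hh ρ hρ X P₁ P₂ hX hP₁X hP₂X₁ hcyl hP₁ hP₂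
    have hc' : 1 / 156 * Real.sqrt (1 - ⟪L e₃, e₃⟫_ℝ ^ 2) ≤ 1 / 156 := by
      obtain ⟨-, h1⟩ := hsin L; linarith only [h1]
    have := mul_le_mul_of_nonneg_right hc' (hπρ ρ)
    linarith only [key, this]
  · -- (B) a doubly skew axis: skew root AND a re-picked axis, frame `L'`
    obtain ⟨w, hw, s, hs, hws, hskew, L', hL', hrise⟩ := exists_skewRoot_of_axis_sine τ k hk A₁
    have hs2 : 0 < Real.sqrt 2 := by positivity
    have h0 : 0 ≤ Real.sqrt (1 - ⟪L' e₃, e₃⟫_ℝ ^ 2) / Real.sqrt 2 := by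
      obtain ⟨h0', -⟩ := hsin L'; positivity
    obtain ⟨C, R₀, hR₀, hmain⟩ := translate_twoSlabAdhesion_censusFree hg hc A₁ t₁ A₂ t₂ htrans hw
      (le_trans h0 hrise) hs hws hskew
    refine ⟨L', t₁, t₂, constHagg, constHagg, isHaggSeq_const, isHaggSeq_const,
      movedFcc_subset_frame_of_image_eq A₁ L' t₁ hL'.symm,
      movedFcc_subset_frame_of_image_eq A₂ L' t₂ (hΛ₂.trans hL'.symm), C, R₀, hR₀, ?_⟩
    intro h hh ρ hρ X P₁ P₂ hX hP₁X hP₂X₁ hcyl hP₁ hP₂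
    have key := hmain h hh ρ hρ X P₁ P₂ hX hP₁X hP₂X₁ hcyl hP₁ hP₂
    have hc' : 1 / 156 * Real.sqrt (1 - ⟪L' e₃, e₃⟫_ℝ ^ 2) ≤ Real.sqrt 2 * (A₁ w) 2 / 156 := by
      have h1 : Real.sqrt (1 - ⟪L' e₃, e₃⟫_ℝ ^ 2) ≤ Real.sqrt 2 * (A₁ w) 2 := by
        have := mul_le_mul_of_nonneg_left hrise hs2.le
        rw [mul_div_cancel₀ _ hs2.ne'] at this
        exact this
      linarith only [h1]
    have := mul_le_mul_of_nonneg_right hc' (hπρ ρ)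
    linarith only [key, this]
  · -- (C) a skew `{111}` plane: the defender's frame `L' = A₁ ∘ G`
    obtain ⟨L', hL', hskew⟩ := exists_skewFrame_of_cube A₁ τ c hcube
    have hsub₁' := movedFcc_subset_frame_of_image_eq A₁ L' t₁ hL'.symm
    have hsub₂' := movedFcc_subset_frame_of_image_eq A₂ L' t₂ (hΛ₂.trans hL'.symm)
    obtain ⟨C, R₀, hR₀, hmain⟩ := coaxialTwoSlabAdhesion_trans_skew_censusFree hg hc A₁ t₁ A₂ t₂
      L' t₁ constHagg isHaggSeq_const hsub₁' htrans hskew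
    refine ⟨L', t₁, t₂, constHagg, constHagg, isHaggSeq_const, isHaggSeq_const, hsub₁', hsub₂', C, R₀, hR₀, ?_⟩
    intro h hh ρ hρ X P₁ P₂ hX hP₁X hP₂X₁ hcyl hP₁ hP₂
    have key := hmain h hh ρ hρ X P₁ P₂ hX hP₁X hP₂X₁ hcyl hP₁ hP₂
    have hc' : 1 / 156 * Real.sqrt (1 - ⟪L' e₃, e₃⟫_ℝ ^ 2) ≤
        Real.sqrt 6 / 312 * Real.sqrt (1 - ⟪L' e₃, e₃⟫_ℝ ^ 2) := by
      obtain ⟨h0', -⟩ := hsin L'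
      have h6 : (2 : ℝ) ≤ Real.sqrt 6 := by
        rw [show (2 : ℝ) = Real.sqrt (2 ^ 2) by rw [Real.sqrt_sq (by norm_num)]]
        exact Real.sqrt_le_sqrt (by norm_num)
      nlinarith [h0', h6]
    have := mul_le_mul_of_nonneg_right hc' (hπρ ρ)
    linarith only [key, this]

/-- **THE INEQUALITY OF `stub_coaxialTwoSlabAdhesion` AT THE UNIFORM CHARGE `1/156`, CENSUS-FREE.**  The text of
`CoaxialTwoSlabAdhesion` (`…WallLedgerFDefs`) with `(1 / 2 : ℝ) ↦ (1 / 156 : ℝ)`: every co-axial pair of distinct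
moved fcc lattices, arbitrary fillings; modulo `KissingGap δ`, `KissingClassification δ` ONLY.  See the module
docstring. -/
theorem coaxialTwoSlabAdhesion_censusFree :
    ∀ (A₁ : EuclideanSpace ℝ (Fin 3) ≃ₗᵢ[ℝ] EuclideanSpace ℝ (Fin 3)) (t₁ : EuclideanSpace ℝ (Fin 3))
      (A₂ : EuclideanSpace ℝ (Fin 3) ≃ₗᵢ[ℝ] EuclideanSpace ℝ (Fin 3)) (t₂ : EuclideanSpace ℝ (Fin 3)),
    (∃ (L : EuclideanSpace ℝ (Fin 3) ≃ₗᵢ[ℝ] EuclideanSpace ℝ (Fin 3))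
        (s₁ s₂ : EuclideanSpace ℝ (Fin 3)) (σ σ' : ℤ → ℤ), IsHaggSeq σ ∧ IsHaggSeq σ' ∧
        (fun p => A₁ p + t₁) '' fccStacking 1 (Real.sqrt (2 / 3)) ⊆
          (fun p => L p + s₁) '' barlowStacking 1 (Real.sqrt (2 / 3)) σ ∧
        (fun p => A₂ p + t₂) '' fccStacking 1 (Real.sqrt (2 / 3)) ⊆
          (fun p => L p + s₂) '' barlowStacking 1 (Real.sqrt (2 / 3)) σ') →
    (fun p => A₁ p + t₁) '' fccStacking 1 (Real.sqrt (2 / 3)) ≠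
      (fun p => A₂ p + t₂) '' fccStacking 1 (Real.sqrt (2 / 3)) →
    ∃ (L : EuclideanSpace ℝ (Fin 3) ≃ₗᵢ[ℝ] EuclideanSpace ℝ (Fin 3))
        (s₁ s₂ : EuclideanSpace ℝ (Fin 3)) (σ σ' : ℤ → ℤ), IsHaggSeq σ ∧ IsHaggSeq σ' ∧
        (fun p => A₁ p + t₁) '' fccStacking 1 (Real.sqrt (2 / 3)) ⊆
          (fun p => L p + s₁) '' barlowStacking 1 (Real.sqrt (2 / 3)) σ ∧
        (fun p => A₂ p + t₂) '' fccStacking 1 (Real.sqrt (2 / 3)) ⊆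
          (fun p => L p + s₂) '' barlowStacking 1 (Real.sqrt (2 / 3)) σ' ∧
    ∃ C R₀ : ℝ, 1 ≤ R₀ ∧ ∀ h : ℝ, 0 ≤ h → ∀ ρ : ℝ, R₀ ≤ ρ →
      ∀ X P₁ P₂ : Finset (EuclideanSpace ℝ (Fin 3)),
      (∀ p ∈ X, ∀ q ∈ X, p ≠ q → 1 ≤ dist p q) → P₁ ⊆ X → P₂ ⊆ X \ P₁ →
      (∀ p ∈ X, -(2 * R₀) ≤ p 2 ∧ p 2 ≤ h + 2 * R₀ ∧ p 0 ^ 2 + p 1 ^ 2 ≤ ρ ^ 2) →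
      (∀ p, p ∈ P₁ ↔ (p ∈ (fun q => A₁ q + t₁) '' fccStacking 1 (Real.sqrt (2 / 3)) ∧
        -(2 * R₀) ≤ p 2 ∧ p 2 ≤ -R₀ ∧ p 0 ^ 2 + p 1 ^ 2 ≤ ρ ^ 2)) →
      (∀ p, p ∈ P₂ ↔ (p ∈ (fun q => A₂ q + t₂) '' fccStacking 1 (Real.sqrt (2 / 3)) ∧
        h + R₀ ≤ p 2 ∧ p 2 ≤ h + 2 * R₀ ∧ p 0 ^ 2 + p 1 ^ 2 ≤ ρ ^ 2)) →
      ((((P₁ ×ˢ (X \ P₁)).filter fun pq => dist pq.1 pq.2 = 1).card : ℕ) : ℝ) +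
        ((((P₂ ×ˢ ((X \ P₁) \ P₂)).filter fun pq => dist pq.1 pq.2 = 1).card : ℕ) : ℝ) ≤
        contactDeficiency ((X \ P₁) \ P₂) +
          (Real.sqrt 2 / 4 * ∑ᶠ w ∈ {w ∈ fccStacking 1 (Real.sqrt (2 / 3)) | ‖w‖ = 1},
              |⟪w, A₁.symm (EuclideanSpace.single (2 : Fin 3) (1 : ℝ))⟫_ℝ| +
            Real.sqrt 2 / 4 * ∑ᶠ w ∈ {w ∈ fccStacking 1 (Real.sqrt (2 / 3)) | ‖w‖ = 1},
              |⟪w, A₂.symm (EuclideanSpace.single (2 : Fin 3) (1 : ℝ))⟫_ℝ| -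
            (1 / 156 : ℝ) * Real.sqrt (1 - ⟪L (EuclideanSpace.single (2 : Fin 3) (1 : ℝ)),
              (EuclideanSpace.single (2 : Fin 3) (1 : ℝ))⟫_ℝ ^ 2)) * Real.pi * ρ ^ 2 +
          C * (1 + h) * ρ := by
  classical
  intro A₁ t₁ A₂ t₂ hcoax hne
  obtain ⟨L, s₁, s₂, σ, σ', hσ, hσ', hsub₁, hsub₂⟩ := hcoax
  by_cases htrans : A₁ '' fccStacking 1 (Real.sqrt (2 / 3)) = A₂ '' fccStacking 1 (Real.sqrt (2 / 3))
  · exact coaxialTwoSlabAdhesion_translate_censusFree hg hc A₁ t₁ A₂ t₂ L s₁ s₂ σ σ' hσ hσ' hsub₁ hsub₂ htrans hne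
  · -- twin pair: 19481-p1's census-free twin law (`√6/312 ≥ 1/156`), frame `L`
    set e₃ : EuclideanSpace ℝ (Fin 3) := EuclideanSpace.single (2 : Fin 3) (1 : ℝ) with he₃
    obtain ⟨C, R₀, hR₀, hmain⟩ := coaxialTwoSlabAdhesion_general_twin_censusFree hg hc A₁ t₁ A₂ t₂ L s₁ s₂ σ σ'
      hσ hσ' hsub₁ hsub₂ htrans
    refine ⟨L, s₁, s₂, σ, σ', hσ, hσ', hsub₁, hsub₂, C, R₀, hR₀, ?_⟩
    intro h hh ρ hρ X P₁ P₂ hX hP₁X hP₂X₁ hcyl hP₁ hP₂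
    have key := hmain h hh ρ hρ X P₁ P₂ hX hP₁X hP₂X₁ hcyl hP₁ hP₂
    have h0 : 0 ≤ Real.sqrt (1 - ⟪L e₃, e₃⟫_ℝ ^ 2) := Real.sqrt_nonneg _
    have h6 : (2 : ℝ) ≤ Real.sqrt 6 := by
      rw [show (2 : ℝ) = Real.sqrt (2 ^ 2) by rw [Real.sqrt_sq (by norm_num)]]
      exact Real.sqrt_le_sqrt (by norm_num)
    have hc' : 1 / 156 * Real.sqrt (1 - ⟪L e₃, e₃⟫_ℝ ^ 2) ≤ Real.sqrt 6 / 312 * Real.sqrt (1 - ⟪L e₃, e₃⟫_ℝ ^ 2) := by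
      nlinarith [h0, h6]
    have hπρ : 0 ≤ Real.pi * ρ ^ 2 := by positivity
    have := mul_le_mul_of_nonneg_right hc' hπρ
    linarith only [key, this]

end CensusFree

/-- **The skeleton composition, uniform in the charge.**  The text of the planner's `CoaxialWallLaw_holds_of_stubs`
(`coaxialWallLaw_of_stubProps` of `…OfCensus`) with the stub's constant `½` replaced by an arbitrary `c`: the
affine-sample deficit bound and the two-slab adhesion inequality at charge `c` give the crux's packing-form
inequality at charge `c`, for every co-axial pair. -/
theorem coaxialWallLaw_at_of_adhesion_at (c : ℝ) (hS : AffineSampleDeficit)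
    (hT : ∀ (A₁ : EuclideanSpace ℝ (Fin 3) ≃ₗᵢ[ℝ] EuclideanSpace ℝ (Fin 3)) (t₁ : EuclideanSpace ℝ (Fin 3))
      (A₂ : EuclideanSpace ℝ (Fin 3) ≃ₗᵢ[ℝ] EuclideanSpace ℝ (Fin 3)) (t₂ : EuclideanSpace ℝ (Fin 3)),
      (∃ (L : EuclideanSpace ℝ (Fin 3) ≃ₗᵢ[ℝ] EuclideanSpace ℝ (Fin 3))
          (s₁ s₂ : EuclideanSpace ℝ (Fin 3)) (σ σ' : ℤ → ℤ), IsHaggSeq σ ∧ IsHaggSeq σ' ∧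
          (fun p => A₁ p + t₁) '' fccStacking 1 (Real.sqrt (2 / 3)) ⊆
            (fun p => L p + s₁) '' barlowStacking 1 (Real.sqrt (2 / 3)) σ ∧
          (fun p => A₂ p + t₂) '' fccStacking 1 (Real.sqrt (2 / 3)) ⊆
            (fun p => L p + s₂) '' barlowStacking 1 (Real.sqrt (2 / 3)) σ') →
      (fun p => A₁ p + t₁) '' fccStacking 1 (Real.sqrt (2 / 3)) ≠
        (fun p => A₂ p + t₂) '' fccStacking 1 (Real.sqrt (2 / 3)) →
      ∃ (L : EuclideanSpace ℝ (Fin 3) ≃ₗᵢ[ℝ] EuclideanSpace ℝ (Fin 3))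
          (s₁ s₂ : EuclideanSpace ℝ (Fin 3)) (σ σ' : ℤ → ℤ), IsHaggSeq σ ∧ IsHaggSeq σ' ∧
          (fun p => A₁ p + t₁) '' fccStacking 1 (Real.sqrt (2 / 3)) ⊆
            (fun p => L p + s₁) '' barlowStacking 1 (Real.sqrt (2 / 3)) σ ∧
          (fun p => A₂ p + t₂) '' fccStacking 1 (Real.sqrt (2 / 3)) ⊆
            (fun p => L p + s₂) '' barlowStacking 1 (Real.sqrt (2 / 3)) σ' ∧
      ∃ C R₀ : ℝ, 1 ≤ R₀ ∧ ∀ h : ℝ, 0 ≤ h → ∀ ρ : ℝ, R₀ ≤ ρ →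
        ∀ X P₁ P₂ : Finset (EuclideanSpace ℝ (Fin 3)),
        (∀ p ∈ X, ∀ q ∈ X, p ≠ q → 1 ≤ dist p q) → P₁ ⊆ X → P₂ ⊆ X \ P₁ →
        (∀ p ∈ X, -(2 * R₀) ≤ p 2 ∧ p 2 ≤ h + 2 * R₀ ∧ p 0 ^ 2 + p 1 ^ 2 ≤ ρ ^ 2) →
        (∀ p, p ∈ P₁ ↔ (p ∈ (fun q => A₁ q + t₁) '' fccStacking 1 (Real.sqrt (2 / 3)) ∧
          -(2 * R₀) ≤ p 2 ∧ p 2 ≤ -R₀ ∧ p 0 ^ 2 + p 1 ^ 2 ≤ ρ ^ 2)) →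
        (∀ p, p ∈ P₂ ↔ (p ∈ (fun q => A₂ q + t₂) '' fccStacking 1 (Real.sqrt (2 / 3)) ∧
          h + R₀ ≤ p 2 ∧ p 2 ≤ h + 2 * R₀ ∧ p 0 ^ 2 + p 1 ^ 2 ≤ ρ ^ 2)) →
        ((((P₁ ×ˢ (X \ P₁)).filter fun pq => dist pq.1 pq.2 = 1).card : ℕ) : ℝ) +
          ((((P₂ ×ˢ ((X \ P₁) \ P₂)).filter fun pq => dist pq.1 pq.2 = 1).card : ℕ) : ℝ) ≤
          contactDeficiency ((X \ P₁) \ P₂) +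
            (Real.sqrt 2 / 4 * ∑ᶠ w ∈ {w ∈ fccStacking 1 (Real.sqrt (2 / 3)) | ‖w‖ = 1},
                |⟪w, A₁.symm (EuclideanSpace.single (2 : Fin 3) (1 : ℝ))⟫_ℝ| +
              Real.sqrt 2 / 4 * ∑ᶠ w ∈ {w ∈ fccStacking 1 (Real.sqrt (2 / 3)) | ‖w‖ = 1},
                |⟪w, A₂.symm (EuclideanSpace.single (2 : Fin 3) (1 : ℝ))⟫_ℝ| -
              c * Real.sqrt (1 - ⟪L (EuclideanSpace.single (2 : Fin 3) (1 : ℝ)),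
                (EuclideanSpace.single (2 : Fin 3) (1 : ℝ))⟫_ℝ ^ 2)) * Real.pi * ρ ^ 2 +
            C * (1 + h) * ρ) :
    ∀ (A₁ : EuclideanSpace ℝ (Fin 3) ≃ₗᵢ[ℝ] EuclideanSpace ℝ (Fin 3)) (t₁ : EuclideanSpace ℝ (Fin 3))
      (A₂ : EuclideanSpace ℝ (Fin 3) ≃ₗᵢ[ℝ] EuclideanSpace ℝ (Fin 3)) (t₂ : EuclideanSpace ℝ (Fin 3)),
    (∃ (L : EuclideanSpace ℝ (Fin 3) ≃ₗᵢ[ℝ] EuclideanSpace ℝ (Fin 3)) (s₁ s₂ : EuclideanSpace ℝ (Fin 3))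
        (σ σ' : ℤ → ℤ), IsHaggSeq σ ∧ IsHaggSeq σ' ∧
        (fun p => A₁ p + t₁) '' fccStacking 1 (Real.sqrt (2 / 3)) ⊆
          (fun p => L p + s₁) '' barlowStacking 1 (Real.sqrt (2 / 3)) σ ∧
        (fun p => A₂ p + t₂) '' fccStacking 1 (Real.sqrt (2 / 3)) ⊆
          (fun p => L p + s₂) '' barlowStacking 1 (Real.sqrt (2 / 3)) σ') →
    (fun p => A₁ p + t₁) '' fccStacking 1 (Real.sqrt (2 / 3)) ≠
      (fun p => A₂ p + t₂) '' fccStacking 1 (Real.sqrt (2 / 3)) →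
    ∃ (L : EuclideanSpace ℝ (Fin 3) ≃ₗᵢ[ℝ] EuclideanSpace ℝ (Fin 3)) (s₁ s₂ : EuclideanSpace ℝ (Fin 3))
        (σ σ' : ℤ → ℤ), IsHaggSeq σ ∧ IsHaggSeq σ' ∧
        (fun p => A₁ p + t₁) '' fccStacking 1 (Real.sqrt (2 / 3)) ⊆
          (fun p => L p + s₁) '' barlowStacking 1 (Real.sqrt (2 / 3)) σ ∧
        (fun p => A₂ p + t₂) '' fccStacking 1 (Real.sqrt (2 / 3)) ⊆
          (fun p => L p + s₂) '' barlowStacking 1 (Real.sqrt (2 / 3)) σ' ∧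
    ∃ C R₀ : ℝ, 0 < R₀ ∧ ∀ h : ℝ, 0 ≤ h → ∀ ρ : ℝ, R₀ ≤ ρ →
      ∀ (N : ℕ) (x : Fin N → EuclideanSpace ℝ (Fin 3)), Summit.Ventures.Crystal3D.IsUnitPacking x →
      (∀ i, -(2 * R₀) ≤ x i 2 ∧ x i 2 ≤ h + 2 * R₀ ∧ x i 0 ^ 2 + x i 1 ^ 2 ≤ ρ ^ 2) →
      (∀ p ∈ (fun p => A₁ p + t₁) '' fccStacking 1 (Real.sqrt (2 / 3)),
        (-(2 * R₀) ≤ p 2 ∧ p 2 ≤ -R₀ ∧ p 0 ^ 2 + p 1 ^ 2 ≤ ρ ^ 2) → ∃ i, x i = p) →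
      (∀ p ∈ (fun p => A₂ p + t₂) '' fccStacking 1 (Real.sqrt (2 / 3)),
        (h + R₀ ≤ p 2 ∧ p 2 ≤ h + 2 * R₀ ∧ p 0 ^ 2 + p 1 ^ 2 ≤ ρ ^ 2) → ∃ i, x i = p) →
      (Real.sqrt 2 / 4 * ∑ᶠ w ∈ {w ∈ fccStacking 1 (Real.sqrt (2 / 3)) | ‖w‖ = 1},
          |⟪w, A₁.symm (EuclideanSpace.single (2 : Fin 3) (1 : ℝ))⟫_ℝ| +
        Real.sqrt 2 / 4 * ∑ᶠ w ∈ {w ∈ fccStacking 1 (Real.sqrt (2 / 3)) | ‖w‖ = 1},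
          |⟪w, A₂.symm (EuclideanSpace.single (2 : Fin 3) (1 : ℝ))⟫_ℝ| +
        c * Real.sqrt (1 - ⟪L (EuclideanSpace.single (2 : Fin 3) (1 : ℝ)),
          (EuclideanSpace.single (2 : Fin 3) (1 : ℝ))⟫_ℝ ^ 2)) * Real.pi * ρ ^ 2 - C * (1 + h) * ρ ≤
        6 * (N : ℝ) - (Summit.Ventures.Crystal3D.numContacts x : ℝ) := by
  classical
  intro A₁ t₁ A₂ t₂ hcoax hne
  obtain ⟨L, s₁, s₂, σ, σ', hσ, hσ', hL₁, hL₂, C, R₀, hR₀, hadh⟩ := hT A₁ t₁ A₂ t₂ hcoax hne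
  obtain ⟨C₁, hC₁⟩ := hS A₁ t₁ R₀ hR₀
  obtain ⟨C₂, hC₂⟩ := hS A₂ t₂ R₀ hR₀
  refine ⟨L, s₁, s₂, σ, σ', hσ, hσ', hL₁, hL₂, |C| + |C₁| + |C₂|, R₀, by linarith, ?_⟩
  intro h hh ρ hρ N x hx hcyl hslab₁ hslab₂
  -- the packing as a finite set, the two samples as filters
  have hxinj : Function.Injective x := hx.injective
  set X : Finset (EuclideanSpace ℝ (Fin 3)) := univ.image x with hX
  set P₁ : Finset (EuclideanSpace ℝ (Fin 3)) := X.filter fun p =>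
    p ∈ (fun q => A₁ q + t₁) '' fccStacking 1 (Real.sqrt (2 / 3)) ∧
      -(2 * R₀) ≤ p 2 ∧ p 2 ≤ -R₀ ∧ p 0 ^ 2 + p 1 ^ 2 ≤ ρ ^ 2 with hP₁
  set P₂ : Finset (EuclideanSpace ℝ (Fin 3)) := (X \ P₁).filter fun p =>
    p ∈ (fun q => A₂ q + t₂) '' fccStacking 1 (Real.sqrt (2 / 3)) ∧
      h + R₀ ≤ p 2 ∧ p 2 ≤ h + 2 * R₀ ∧ p 0 ^ 2 + p 1 ^ 2 ≤ ρ ^ 2 with hP₂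
  have hXpack : ∀ p ∈ X, ∀ q ∈ X, p ≠ q → 1 ≤ dist p q := by
    intro p hp q hq hpq
    obtain ⟨i, -, rfl⟩ := mem_image.1 hp
    obtain ⟨j, -, rfl⟩ := mem_image.1 hq
    exact hx.one_le_dist fun hij => hpq (by rw [hij])
  have hP₁X : P₁ ⊆ X := filter_subset _ _
  have hP₂X : P₂ ⊆ X \ P₁ := filter_subset _ _
  have hXcyl : ∀ p ∈ X, -(2 * R₀) ≤ p 2 ∧ p 2 ≤ h + 2 * R₀ ∧ p 0 ^ 2 + p 1 ^ 2 ≤ ρ ^ 2 := by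
    intro p hp
    obtain ⟨i, -, rfl⟩ := mem_image.1 hp
    exact hcyl i
  have hP₁iff : ∀ p, p ∈ P₁ ↔ (p ∈ (fun q => A₁ q + t₁) '' fccStacking 1 (Real.sqrt (2 / 3)) ∧
      -(2 * R₀) ≤ p 2 ∧ p 2 ≤ -R₀ ∧ p 0 ^ 2 + p 1 ^ 2 ≤ ρ ^ 2) := by
    intro p
    rw [hP₁, mem_filter]
    refine ⟨fun hp => hp.2, fun hp => ⟨?_, hp⟩⟩
    obtain ⟨i, hi⟩ := hslab₁ p hp.1 ⟨hp.2.1, hp.2.2.1, hp.2.2.2⟩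
    exact mem_image.2 ⟨i, mem_univ _, hi⟩
  have hP₂iff : ∀ p, p ∈ P₂ ↔ (p ∈ (fun q => A₂ q + t₂) '' fccStacking 1 (Real.sqrt (2 / 3)) ∧
      h + R₀ ≤ p 2 ∧ p 2 ≤ h + 2 * R₀ ∧ p 0 ^ 2 + p 1 ^ 2 ≤ ρ ^ 2) := by
    intro p
    rw [hP₂, mem_filter]
    refine ⟨fun hp => hp.2, fun hp => ⟨?_, hp⟩⟩
    obtain ⟨i, hi⟩ := hslab₂ p hp.1 ⟨hp.2.1, hp.2.2.1, hp.2.2.2⟩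
    rw [mem_sdiff]
    refine ⟨mem_image.2 ⟨i, mem_univ _, hi⟩, fun hp1 => ?_⟩
    have h1 := ((hP₁iff p).1 hp1).2.2.1
    have h2 := hp.2.1
    linarith
  -- the three inequalities and the two splits
  have hadh' := hadh h hh ρ hρ X P₁ P₂ hXpack hP₁X hP₂X hXcyl hP₁iff hP₂iff
  have hD₁ := hC₁ (-(2 * R₀)) (-R₀) (by ring) ρ hρ P₁ hP₁iff
  have hD₂ := hC₂ (h + R₀) (h + 2 * R₀) (by ring) ρ hρ P₂ hP₂iff
  have hsplit₁ := contactDeficiency_sdiff_split hP₁X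
  have hsplit₂ := contactDeficiency_sdiff_split hP₂X
  have hDX : contactDeficiency X = 6 * (N : ℝ) - (numContacts x : ℝ) :=
    contactDeficiency_image_eq x hxinj
  rw [← hDX]
  have hρ0 : (0 : ℝ) ≤ ρ := by linarith
  have ha : C * (1 + h) * ρ ≤ |C| * (1 + h) * ρ := by
    have h1 : 0 ≤ (|C| - C) * ((1 + h) * ρ) := mul_nonneg (by linarith only [le_abs_self C]) (by positivity)
    linarith only [h1]
  have hb : C₁ * ρ ≤ |C₁| * (1 + h) * ρ := by
    have h1 : 0 ≤ (|C₁| - C₁) * ρ := mul_nonneg (by linarith only [le_abs_self C₁]) hρ0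
    have h2 : 0 ≤ |C₁| * h * ρ := by positivity
    linarith only [h1, h2]
  have hc' : C₂ * ρ ≤ |C₂| * (1 + h) * ρ := by
    have h1 : 0 ≤ (|C₂| - C₂) * ρ := mul_nonneg (by linarith only [le_abs_self C₂]) hρ0
    have h2 : 0 ≤ |C₂| * h * ρ := by positivity
    linarith only [h1, h2]
  linarith only [hadh', hD₁, hD₂, hsplit₁, hsplit₂, ha, hb, hc']

/-- **THE CRUX `CoaxialWallLaw` VERBATIM AT THE UNIFORM CHARGE `1/156` IN PLACE OF `½`, CENSUS-FREE** — for EVERY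
co-axial pair of distinct moved fcc lattices, modulo `KissingGap δ`, `KissingClassification δ` ONLY (admissible;
no E1 row, no `KFoldTopDeficit`).  F's standing law (×52 over `coaxialWallLaw_smallCharge`).  See the module
docstring. -/
theorem coaxialWallLaw_censusFree {δ : ℝ} (hg : KissingGap δ) (hc : KissingClassification δ) :
    ∀ (A₁ : EuclideanSpace ℝ (Fin 3) ≃ₗᵢ[ℝ] EuclideanSpace ℝ (Fin 3)) (t₁ : EuclideanSpace ℝ (Fin 3))
      (A₂ : EuclideanSpace ℝ (Fin 3) ≃ₗᵢ[ℝ] EuclideanSpace ℝ (Fin 3)) (t₂ : EuclideanSpace ℝ (Fin 3)),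
    (∃ (L : EuclideanSpace ℝ (Fin 3) ≃ₗᵢ[ℝ] EuclideanSpace ℝ (Fin 3)) (s₁ s₂ : EuclideanSpace ℝ (Fin 3))
        (σ σ' : ℤ → ℤ), IsHaggSeq σ ∧ IsHaggSeq σ' ∧
        (fun p => A₁ p + t₁) '' fccStacking 1 (Real.sqrt (2 / 3)) ⊆
          (fun p => L p + s₁) '' barlowStacking 1 (Real.sqrt (2 / 3)) σ ∧
        (fun p => A₂ p + t₂) '' fccStacking 1 (Real.sqrt (2 / 3)) ⊆
          (fun p => L p + s₂) '' barlowStacking 1 (Real.sqrt (2 / 3)) σ') →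
    (fun p => A₁ p + t₁) '' fccStacking 1 (Real.sqrt (2 / 3)) ≠
      (fun p => A₂ p + t₂) '' fccStacking 1 (Real.sqrt (2 / 3)) →
    ∃ (L : EuclideanSpace ℝ (Fin 3) ≃ₗᵢ[ℝ] EuclideanSpace ℝ (Fin 3)) (s₁ s₂ : EuclideanSpace ℝ (Fin 3))
        (σ σ' : ℤ → ℤ), IsHaggSeq σ ∧ IsHaggSeq σ' ∧
        (fun p => A₁ p + t₁) '' fccStacking 1 (Real.sqrt (2 / 3)) ⊆
          (fun p => L p + s₁) '' barlowStacking 1 (Real.sqrt (2 / 3)) σ ∧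
        (fun p => A₂ p + t₂) '' fccStacking 1 (Real.sqrt (2 / 3)) ⊆
          (fun p => L p + s₂) '' barlowStacking 1 (Real.sqrt (2 / 3)) σ' ∧
    ∃ C R₀ : ℝ, 0 < R₀ ∧ ∀ h : ℝ, 0 ≤ h → ∀ ρ : ℝ, R₀ ≤ ρ →
      ∀ (N : ℕ) (x : Fin N → EuclideanSpace ℝ (Fin 3)), Summit.Ventures.Crystal3D.IsUnitPacking x →
      (∀ i, -(2 * R₀) ≤ x i 2 ∧ x i 2 ≤ h + 2 * R₀ ∧ x i 0 ^ 2 + x i 1 ^ 2 ≤ ρ ^ 2) →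
      (∀ p ∈ (fun p => A₁ p + t₁) '' fccStacking 1 (Real.sqrt (2 / 3)),
        (-(2 * R₀) ≤ p 2 ∧ p 2 ≤ -R₀ ∧ p 0 ^ 2 + p 1 ^ 2 ≤ ρ ^ 2) → ∃ i, x i = p) →
      (∀ p ∈ (fun p => A₂ p + t₂) '' fccStacking 1 (Real.sqrt (2 / 3)),
        (h + R₀ ≤ p 2 ∧ p 2 ≤ h + 2 * R₀ ∧ p 0 ^ 2 + p 1 ^ 2 ≤ ρ ^ 2) → ∃ i, x i = p) →
      (Real.sqrt 2 / 4 * ∑ᶠ w ∈ {w ∈ fccStacking 1 (Real.sqrt (2 / 3)) | ‖w‖ = 1},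
          |⟪w, A₁.symm (EuclideanSpace.single (2 : Fin 3) (1 : ℝ))⟫_ℝ| +
        Real.sqrt 2 / 4 * ∑ᶠ w ∈ {w ∈ fccStacking 1 (Real.sqrt (2 / 3)) | ‖w‖ = 1},
          |⟪w, A₂.symm (EuclideanSpace.single (2 : Fin 3) (1 : ℝ))⟫_ℝ| +
        (1 / 156 : ℝ) * Real.sqrt (1 - ⟪L (EuclideanSpace.single (2 : Fin 3) (1 : ℝ)),
          (EuclideanSpace.single (2 : Fin 3) (1 : ℝ))⟫_ℝ ^ 2)) * Real.pi * ρ ^ 2 - C * (1 + h) * ρ ≤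
        6 * (N : ℝ) - (Summit.Ventures.Crystal3D.numContacts x : ℝ) :=
  -- line F's S/M stub `AffineSampleDeficit` IS the landed `Theorems.stub_affineSampleDeficit` of line G (same body)
  coaxialWallLaw_at_of_adhesion_at (1 / 156 : ℝ) Summit.Ventures.Crystal3D.Theorems.stub_affineSampleDeficit
    (coaxialTwoSlabAdhesion_censusFree hg hc)

end Summit.Ventures.Crystal3D.Theorems

end
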